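import Summits.QuantumFields.YangMills.Theorems.BalabanUVNodesN11NoExpansionDiagonalCoPH
import Literature.MathematicalPhysics.QuantumFieldTheory.Balaban1983to89.Node00.Record13SepCoPHChi
import Literature.MathematicalPhysics.QuantumFieldTheory.Balaban1983to89.Node00.Record13ResidualsRChi
import Summits.QuantumFields.YangMills.Theorems.BalabanUVNodesN11NoExpansionAtRecord13CoPChi

/-!
# χ-GENERIC RE-ISSUE (WORK ORDER RC-1 «RE-CENTRE THE RECORD», director-ym №462 (B) ∕ №467 (D)) of `BalabanUVNodesN11NoExpansionDiagonalCoPH`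

Cell `pub-ymgap` (HUMAN RULING D-0062, Track A), seat `pub-ymgap-dag-n11-d` (N11 [B14] s2; N11-σ campaign, `N11-G44-RC1-REACH-CENSUS.md`).  The CENTRE-TYPED
declarations of `BalabanUVNodesN11NoExpansionDiagonalCoPH` (those whose statement reads the (2.9) cut-off centre through `gOfRecord₁₃ ∕ EOfRecord₁₃ ∕ Provisos₁₃… ∕ T∕SLaw₁₃… ∕
UbgOfRecord₁₃… ∕ WtOfRecord₁₃… ∕ datum∕tower∕coreOfRecord₁₃…`) RE-ISSUED VERBATIM in the β-slot `χ : ChiSlot F N` over [Ax-3b]∕[Ax-3c]∕[Ax-3d]'s χ-generic carriers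
(`Node00/Record13Chi` ∕ `Record13CoPHChi` ∕ `Record13SepCoPHChi`): σ = (binder `(χ : ChiSlot F N)` after `θ`; Node00 defs `X ↦ XChi … χ`; Node00 rows `Y ↦ Y_chi`;
this lane's sibling modules `…Chi` for Summits-side dependencies); SAME short names in the sibling namespace `…BalabanUVNodesN11NoExpansionDiagonalCoPHChi` (consumers switch by namespace);
the 11 centre-FREE declarations of the original are NOT copied — they are reused BY NAME (`open … (…)` below).  At `χ := chiβOfRecord₁₃ θ` every statement here is
DEFINITIONALLY the landed one ([Ax-3b]'s `rfl` receipts); at `χ := chiβOfRecord₁₃Ax θ` it is what the Ax-record's N11 machine reads.  Nothing of record edited (body-freeze №460 (2)).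

HONEST FRAMING.  Count-neutral kernel re-elaboration of landed N11 bookkeeping∕estimates in a parameter; every HYPOTHESIS of the original stays a hypothesis; nothing of
Bałaban asserted beyond what the original file proves; N11 NOT discharged; K-items untouched; counts unmoved.  One finite `𝕋⁴_{L^K}` programme at fixed `ε = L^{−K}` —
NOT ℝ⁴, NOT OS, NOT a mass gap, NOT Clay.  No `sorry`∕`instance`∕`notation`.  Sources: as the original module, plus [I] = [Balaban1987RG1] (2.9) p.266 (the cut-off's centre).
-/

noncomputable section

open MeasureTheory
open scoped BigOperators Matrix.Norms.L2Operator

namespace Summit.QuantumFields.YangMills.Theorems.BalabanUVNodesN11NoExpansionDiagonalCoPHChi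

open Summit.QuantumFields.YangMills.Theorems.BalabanUVNodesN11NoExpansionDiagonalCoPH (action23_congr_residual sect2Operand_congr_residual sect2Slot_congr_residual sect2Operand_eq_of_forall_Omega_empty sect2Operand_congr_residual_of_forall_Omega_empty sect2Slot_congr_residual_of_forall_Omega_empty zhAt_eq forall_Omega_empty_of_one slotsT_one_ae_eq_sect2Slot_CoPH_of_zeta0_pin hasSect2FormAtZS_clause_one_CoPH_of_zeta0_pin hasSect2FormAtZS_clause_one_CoPH_of_provisos)
open Literature.MathematicalPhysics.QuantumFieldTheory.Balaban1983to89 T4Continuum Node00 Node00.Tk DagBinding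
open B15DeterminingSets
open BalabanUVNodesN11NoExpansionTermFree (action23_of_forall_Omega_empty)
open BalabanUVNodesN11NoExpansionAllLargeCoP (init_allLarge)
open BalabanUVNodesN11NoExpansionDiagonalAtZ (slotsT_one_ae_eq_sect2Slot_atZ_of_zeta0_pin)

variable {F : T4Family} {N : ℕ} [NeZero N]

/-! ## §1. The §2 residual datum is not read by the (2.23) action ∕ operand ∕ slot of record -/

section Residual

variable {𝔸 : Type*} [NormedRing 𝔸] [NormedAlgebra ℂ 𝔸] [CompleteSpace 𝔸]
variable {ν : Stage7Numerics} {M : ℕ} {g : ℕ → ℝ} {K n : ℕ}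

end Residual

/-! ## §2. Faces of the v1.7 record's history-indexed weights -/

section Faces

variable (θ : Stage13HParams F N) (χ : ChiSlot F N) (p : B12.RunParams)

/-- The run's weights for the history `s` ARE 12a″'s weights over the residual serving `s` (`rfl`). [cite: Balaban1988Convergent, (2.21) p.258, p.257 (bookkeeping)] -/
theorem WtOfRecord₁₃H_eq_tkWeightsOfRecordP {n : ℕ} (s : SeqOfRecord F θ.ν θ.τ9.M (gOfRecord₁₃Chi F N θ.toStage13Params χ p) p.K n) :
    WtOfRecord₁₃HChi F N θ χ p s = tkWeightsOfRecordP F N (FluctV N) θ.ν θ.A₁ p (gOfRecord₁₃Chi F N θ.toStage13Params χ p) (θ.zhAtChi χ p s) := rfl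

end Faces

/-! ## §3. ★ Level one of `TLaw₁₃CoPH` at the all-large-field new sequence under the generation-0 pin on `θ.zhAt p s′` -/

section LevelOne

variable (θ : Stage13HParams F N) (χ : ChiSlot F N) (p : B12.RunParams)

end LevelOne

end Summit.QuantumFields.YangMills.Theorems.BalabanUVNodesN11NoExpansionDiagonalCoPHChi

end
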